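import Literature.AnabelianGeometry.EtaleTheta.Discharge.Sec3Thm37iNode
import Literature.AnabelianGeometry.EtaleTheta.Discharge.Sec3Thm37ivGenuineBase
import Literature.AnabelianGeometry.EtaleTheta.Discharge.Sec3Thm37UnitsWeak
import Literature.AnabelianGeometry.EtaleTheta.Discharge.Sec3BLambdaInjectiveOfRlfRWeakReflects
import Literature.AnabelianGeometry.EtaleTheta.BiKummerThm44SubModelConnectedBaseInj
import Literature.AnabelianGeometry.EtaleTheta.TemperedFrobenioidOfDiagonalBaseR
import Literature.AnabelianGeometry.EtaleTheta.TemperedFrobenioidOfGaloisCoveringZTower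
import HarnessLib

/-!
# [EtTh] Theorem 3.7 (i) — the NODE at the GENUINE base `B^temp(Π)⁰` (FSM clause discharged), at the weak `Λ = ℝ` data
# (`hinj` discharged), and at the ℤ-tower models of record over `B^temp(Π^tp_X)⁰` with NO binder (`Λ = ℝ`) /
# clauses (2)–(7) (`Λ = ℤ`)

S. Mochizuki, *The étale theta function and its Frobenioid-theoretic manifestations*, Publ. RIMS **45** (2009) [EtTh], §3,
Theorem 3.7 (i): statement PDF p.79 (printed p.305) ll.30–31, proof PDF p.80 ll.8–15 [cite: MochizukiEtTh2009, Thm 3.7 (i) p.79]: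

> "(i) If `Λ = ℤ` (respectively, `Λ = ℝ`), then `C` is of unit-profinite (respectively, unit-trivial) type.  For arbitrary
> `Λ`, the Frobenioid `C` is of isotropic, model [hence, in particular, birationally Frobenius-normalized], and
> sub-quasi-Frobenius-trivial type, but not of group-like type."

PROOF-ONLY companion (theorems only; abc-iut cell, layer L2, cone node `EtTh:Thm3.7(i)`; abc-iut-L2-lead gen 7 rows R937/R951
«Thm3.7(i) sequel: census of the binders of `Sec3Thm37iNode` at the genuine base / `ofRlfZ·R` / models of record + ONE
end-knit», seat abc-iut-w5-d179 gen 8).  abc-iut-w4-d103's node closer `TemperedFrobenioid.thm37_i_node (hBmon) (hP34) (hinj)`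
(`Sec3Thm37iNode`, p455829) carries THREE binders; its `_of_laws` form splits `hBmon` into {`BaseInj`, `hFSM`}.  Which of them the
TREE now produces, and where — consumed BY NAME, nothing landed is edited or restated:
* §1 **genuine base `D = B^temp(Π)⁰`** (any topological group `Π`): the FSM clause is a THEOREM ([FrdII] Ex. 1.3 (i),
  `QuasiTemperoid.BTempConnected.connectedPart_isOfFSMType`, through abc-iut-w5-d179's
  `isMonoidOn_ratFnFunctor_connectedPart_of_baseInj`) ⇒ **`thm37_i_node_connectedPart_of_baseInj (hBD) (hP34) (hinj)`** — the
  node with residual {`hBD` (= the owner's law `BaseInj` at this base), `hP34` (only if `Λ = ℤ`: Prop. 3.4 (ii) iso 1 in tree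
  currency), `hinj` (only if `Λ = ℝ`)} — the (i)-twin of abc-iut-w4-d103's `thm37_iv_node_connectedPart_of_baseInj`; and
  `thm37_i_of_slots_connectedPart_of_baseInj` (the typed `Thm37_i F` at the facade reading slots, same residual).
* §2 **weak `Λ = ℝ` data `ofRlfRWeak dm hpf` over `B^temp(Π)⁰`**: `hinj` is a THEOREM (`RealifiedDivisorMonoids.ofRlfRWeak_divΛ_injective`,
  abc-iut-L6-t12 / w5-d164) and `hP34` is VACUOUS (`Λ = ℝ ≠ ℤ`) ⇒ **`thm37_i_node_ofRlfRWeak_connectedPart_of_baseInj (hBD)`**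
  and `…_of_hBinj (hBinj)` — ALL SEVEN printed clauses modulo the single structural law `hBD` / `hBinj`.
* §3 **MODEL OF RECORD over the genuine base, NO binder** (`Λ = ℝ`): at abc-iut-w5-d179's ℤ-tower tempered Frobenioid
  `ZTowerTempered.temperedFrobenioidR X φ R S` (p469405; base `B^temp(Π^tp_X)⁰`, every `X`, every character `φ`) `hBinj` holds
  (`ofRlfRWeak_hBinj_of_reflects` ⟸ injective, divisibility-reflecting `Φ₀`-transitions of `DivisorMonoids.ofGaloisActionCosetCat`)
  ⇒ **`ZTowerTempered.thm37_i_temperedFrobenioidR`**: the node's seven clauses with NO hypothesis — the first instance of the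
  (i) node over a MULTI-OBJECT genuine base (abc-iut-L2-d2's `TateTowerKummer.thm37_temperedFrobenioidR`, p467759, is the
  rank-one v2 model).
* §4 **`Λ = ℤ` at the ℤ-tower** `ZTowerTempered.temperedFrobenioid X φ R S` (p463800): `hBmon` ⟸ `hBD` PROVED (`ZTowerTempered.hBD`),
  clause (2) vacuous ⇒ **`ZTowerTempered.thm37_i_clauses_two_to_seven_temperedFrobenioid`**: clauses (2)–(7) with NO hypothesis;
  clause (1) «unit-profinite» stays on the binder `hP34` (print: "By Proposition 3.4, (ii)" — `Ker ≅ O_L^×` for a p-adic `L`,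
  NOT available at a combinatorial model whose unit groups are finite; the finite-kernel route `AdmitsTfgProfiniteTopology.of_finite`
  of abc-iut-f-125's `Sec3Thm37TorsionToy` would close it DEGENERATELY and is deliberately not taken here) ⇒
  `ZTowerTempered.thm37_i_node_temperedFrobenioid (hP34)`.
HONEST FRAMING: refereed pre-IUT material ([EtTh] §3 over [FrdI] §§1–5); bookkeeping over PROVED rows, no new mathematics; the
models are class-(b) combinatorial design models; nothing here bears on [IUTchIII] Cor. 3.12; no side taken; typed ≠ proved —
here PROVED modulo the literal binders displayed.
-/

noncomputable section

namespace Literature.AnabelianGeometry.EtaleTheta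

open CategoryTheory Opposite Function Literature.AlgebraicGeometry.Frobenioids Literature.AnabelianGeometry.SemiGraphs

universe u₀ v₀ u v w uK

namespace TemperedFrobenioid

/-! ### §1 The node at the genuine base `B^temp(Π)⁰`: the FSM clause discharged -/

section ConnectedTemperoid

variable {G : Type u} [Group G] [TopologicalSpace G] {D₀ : Type u₀} [Category.{v₀} D₀] {V : FrdIMonoidStub.{w}}
  {T : RealifiedDivisorMonoids (D₀ := D₀) V}
  {IsRational IsStrictlyRational : ((ConnectedPart (BTemp G))ᵒᵖ ⥤ CommMonCat.{w}) → Prop}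
  (C₀ : TemperedFrobenioid T (ConnectedPart (BTemp G)) (treeCatVocab (ConnectedPart (BTemp G)) IsRational IsStrictlyRational))
  {p : ℕ} [Fact p.Prime]

/-- **[EtTh] Thm 3.7 (i) — the node in print's shape AT THE GENUINE BASE `B^temp(Π)⁰`** ([FrdII] Ex. 1.3 (i): `B^temp(Π)⁰` is of
FSM-type, so «`B` is a monoid on `D`» needs only the base-image injectivity `hBD` of `B₀^Λ` — `isMonoidOn_ratFnFunctor_connectedPart_of_baseInj`):
residual = {`hBD`, `hP34` (only if `Λ = ℤ`), `hinj` (only if `Λ = ℝ`)}.  The (i)-twin of `thm37_iv_node_connectedPart_of_baseInj`.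
[cite: MochizukiEtTh2009, Thm 3.7 (i) p.79] -/
theorem thm37_i_node_connectedPart_of_baseInj
    (hBD : ∀ {A B : ConnectedPart (BTemp G)} (α : B ⟶ A), Injective (T.BΛ.map (C₀.base.map α).op).hom)
    (hP34 : C₀.monoidType = MonoidType.Z → ∀ A : (ConnectedPart (BTemp G))ᵒᵖ, ∃ L : PadicFrd.PadicFld.{uK} p,
      L.IsPadicLocal ∧ Nonempty (((T.divΛ (C₀.baseOp A)).comp (Units.coeHom (T.BΛ.obj (C₀.baseOp A)))).ker ≃*
        PadicFrd.unitSubgroup L.K))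
    (hinj : C₀.monoidType = MonoidType.R → ∀ A : (ConnectedPart (BTemp G))ᵒᵖ, Injective (T.divΛ (C₀.baseOp A))) :
    (C₀.monoidType = MonoidType.Z → PreFrobenioid.IsOfUnitProfiniteType C₀.toElem) ∧
      (C₀.monoidType = MonoidType.R → PreFrobenioid.IsOfType (PreFrobenioid.IsUnitTrivial C₀.toElem)) ∧
      PreFrobenioid.IsOfIsotropicType C₀.toElem ∧
      PreFrobenioid.IsOfModelType C₀.toElem
        (C₀.isFrobenioid_treeCatVocab_of_isMonoidOn (C₀.isMonoidOn_ratFnFunctor_connectedPart_of_baseInj hBD))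
        (PreFrobenioid.hasBiratSquares_of_isFrobenioid
          (C₀.isFrobenioid_treeCatVocab_of_isMonoidOn (C₀.isMonoidOn_ratFnFunctor_connectedPart_of_baseInj hBD))) ∧
      PreFrobenioidData.IsOfBiratFrobeniusNormalizedType
        (PreFrobenioid.biratData
          (C₀.isFrobenioid_treeCatVocab_of_isMonoidOn (C₀.isMonoidOn_ratFnFunctor_connectedPart_of_baseInj hBD))
          (PreFrobenioid.hasBiratSquares_of_isFrobenioid
            (C₀.isFrobenioid_treeCatVocab_of_isMonoidOn (C₀.isMonoidOn_ratFnFunctor_connectedPart_of_baseInj hBD)))) ∧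
      PreFrobenioid.IsOfType (PreFrobenioid.IsSubQuasiFrobeniusTrivial C₀.toElem) ∧
      ¬ PreFrobenioid.IsOfType (PreFrobenioid.IsGroupLikeObj C₀.toElem) :=
  C₀.thm37_i_node (p := p) (C₀.isMonoidOn_ratFnFunctor_connectedPart_of_baseInj hBD) hP34 hinj

/-- **The typed node `Thm37_i F` at the facade reading slots, AT THE GENUINE BASE** (residual {`hBD`, `hP34` (ℤ), `hinj` (ℝ)} plus
the three honest reading slots `hUP`, `hMT`, `hBFN` of `thm37_i_of_slots`). [cite: MochizukiEtTh2009, Thm 3.7 (i) p.79] -/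
theorem thm37_i_of_slots_connectedPart_of_baseInj (F : FrobenioidFacade.{u + 1, u, w} (ConnectedPart (BTemp G)))
    (hBD : ∀ {A B : ConnectedPart (BTemp G)} (α : B ⟶ A), Injective (T.BΛ.map (C₀.base.map α).op).hom)
    (hP34 : C₀.monoidType = MonoidType.Z → ∀ A : (ConnectedPart (BTemp G))ᵒᵖ, ∃ L : PadicFrd.PadicFld.{uK} p,
      L.IsPadicLocal ∧ Nonempty (((T.divΛ (C₀.baseOp A)).comp (Units.coeHom (T.BΛ.obj (C₀.baseOp A)))).ker ≃*
        PadicFrd.unitSubgroup L.K))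
    (hinj : C₀.monoidType = MonoidType.R → ∀ A : (ConnectedPart (BTemp G))ᵒᵖ, Injective (T.divΛ (C₀.baseOp A)))
    (hUP : PreFrobenioid.IsOfUnitProfiniteType C₀.toElem → F.IsOfUnitProfiniteType C₀.toElem)
    (hMT : PreFrobenioid.IsOfModelType C₀.toElem
        (C₀.isFrobenioid_treeCatVocab_of_isMonoidOn (C₀.isMonoidOn_ratFnFunctor_connectedPart_of_baseInj hBD))
        (PreFrobenioid.hasBiratSquares_of_isFrobenioid
          (C₀.isFrobenioid_treeCatVocab_of_isMonoidOn (C₀.isMonoidOn_ratFnFunctor_connectedPart_of_baseInj hBD))) →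
      F.IsOfModelType C₀.toElem)
    (hBFN : PreFrobenioidData.IsOfBiratFrobeniusNormalizedType
        (PreFrobenioid.biratData
          (C₀.isFrobenioid_treeCatVocab_of_isMonoidOn (C₀.isMonoidOn_ratFnFunctor_connectedPart_of_baseInj hBD))
          (PreFrobenioid.hasBiratSquares_of_isFrobenioid
            (C₀.isFrobenioid_treeCatVocab_of_isMonoidOn (C₀.isMonoidOn_ratFnFunctor_connectedPart_of_baseInj hBD)))) →
      F.IsOfBiratFrobeniusNormalizedType C₀.toElem) :
    C₀.Thm37_i F :=
  C₀.thm37_i_of_slots (p := p) F (C₀.isMonoidOn_ratFnFunctor_connectedPart_of_baseInj hBD) hP34 hinj hUP hMT hBFN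

end ConnectedTemperoid

/-! ### §2 The weak `Λ = ℝ` data `ofRlfRWeak` over `B^temp(Π)⁰`: `hinj` discharged, `hP34` vacuous -/

section OfRlfRWeak

variable {G : Type u} [Group G] [TopologicalSpace G] {D₀ : Type u₀} [Category.{v₀} D₀] (dm : DivisorMonoids.{u₀, v₀, w} D₀)
  (hpf : ∀ Y : D₀ᵒᵖ, IsPerfFactorialCof (dm.Φ₀.obj Y))
  {IsRational IsStrictlyRational : ((ConnectedPart (BTemp G))ᵒᵖ ⥤ CommMonCat.{w}) → Prop}
  (C₁ : TemperedFrobenioid (RealifiedDivisorMonoids.ofRlfRWeak dm hpf) (ConnectedPart (BTemp G))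
    (treeCatVocab (ConnectedPart (BTemp G)) IsRational IsStrictlyRational))

/-- **[EtTh] Thm 3.7 (i), all seven clauses, for every tempered Frobenioid of monoid type `ℝ` over the weak constructed data
`ofRlfRWeak dm hpf` and the genuine base `B^temp(Π)⁰`, modulo `hBD` ALONE**: `hinj` is `ofRlfRWeak_divΛ_injective`, the `Λ = ℤ`
clause is vacuous, the FSM clause is [FrdII] Ex. 1.3 (i). [cite: MochizukiEtTh2009, Thm 3.7 (i) p.79] -/
theorem thm37_i_node_ofRlfRWeak_connectedPart_of_baseInj
    (hBD : ∀ {A B : ConnectedPart (BTemp G)} (α : B ⟶ A),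
      Injective ((RealifiedDivisorMonoids.ofRlfRWeak dm hpf).BΛ.map (C₁.base.map α).op).hom) :
    (C₁.monoidType = MonoidType.Z → PreFrobenioid.IsOfUnitProfiniteType C₁.toElem) ∧
      (C₁.monoidType = MonoidType.R → PreFrobenioid.IsOfType (PreFrobenioid.IsUnitTrivial C₁.toElem)) ∧
      PreFrobenioid.IsOfIsotropicType C₁.toElem ∧
      PreFrobenioid.IsOfModelType C₁.toElem
        (C₁.isFrobenioid_treeCatVocab_of_isMonoidOn (C₁.isMonoidOn_ratFnFunctor_connectedPart_of_baseInj hBD))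
        (PreFrobenioid.hasBiratSquares_of_isFrobenioid
          (C₁.isFrobenioid_treeCatVocab_of_isMonoidOn (C₁.isMonoidOn_ratFnFunctor_connectedPart_of_baseInj hBD))) ∧
      PreFrobenioidData.IsOfBiratFrobeniusNormalizedType
        (PreFrobenioid.biratData
          (C₁.isFrobenioid_treeCatVocab_of_isMonoidOn (C₁.isMonoidOn_ratFnFunctor_connectedPart_of_baseInj hBD))
          (PreFrobenioid.hasBiratSquares_of_isFrobenioid
            (C₁.isFrobenioid_treeCatVocab_of_isMonoidOn (C₁.isMonoidOn_ratFnFunctor_connectedPart_of_baseInj hBD)))) ∧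
      PreFrobenioid.IsOfType (PreFrobenioid.IsSubQuasiFrobeniusTrivial C₁.toElem) ∧
      ¬ PreFrobenioid.IsOfType (PreFrobenioid.IsGroupLikeObj C₁.toElem) :=
  have hBmon := C₁.isMonoidOn_ratFnFunctor_connectedPart_of_baseInj hBD
  ⟨fun h => absurd ((C₁.monoidType_ofRlfRWeak dm hpf).symm.trans h) (by decide),
    fun _ => C₁.thm37_i_unitTrivial_ofRlfRWeak dm hpf (C₁.isFrobenioid_treeCatVocab_of_isMonoidOn hBmon),
    C₁.thm37_i_treeClauses5_treeCatVocab hBmon⟩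

/-- The same with the `D₀`-wide form `hBinj` (it implies `hBD`; at `ofRlfRWeak` it follows from injective, divisibility-reflecting
`Φ₀`-transitions, `ofRlfRWeak_hBinj_of_reflects`). [cite: MochizukiEtTh2009, Thm 3.7 (i) p.79] -/
theorem thm37_i_node_ofRlfRWeak_connectedPart_of_hBinj
    (hBinj : ∀ {Y Y' : D₀ᵒᵖ} (g : Y ⟶ Y'), Injective ((RealifiedDivisorMonoids.ofRlfRWeak dm hpf).BΛ.map g).hom) :
    (C₁.monoidType = MonoidType.Z → PreFrobenioid.IsOfUnitProfiniteType C₁.toElem) ∧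
      (C₁.monoidType = MonoidType.R → PreFrobenioid.IsOfType (PreFrobenioid.IsUnitTrivial C₁.toElem)) ∧
      PreFrobenioid.IsOfIsotropicType C₁.toElem ∧
      PreFrobenioid.IsOfModelType C₁.toElem
        (C₁.isFrobenioid_treeCatVocab_of_isMonoidOn
          (C₁.isMonoidOn_ratFnFunctor_connectedPart_of_baseInj fun α => hBinj (C₁.base.map α).op))
        (PreFrobenioid.hasBiratSquares_of_isFrobenioid
          (C₁.isFrobenioid_treeCatVocab_of_isMonoidOn
            (C₁.isMonoidOn_ratFnFunctor_connectedPart_of_baseInj fun α => hBinj (C₁.base.map α).op))) ∧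
      PreFrobenioidData.IsOfBiratFrobeniusNormalizedType
        (PreFrobenioid.biratData
          (C₁.isFrobenioid_treeCatVocab_of_isMonoidOn
            (C₁.isMonoidOn_ratFnFunctor_connectedPart_of_baseInj fun α => hBinj (C₁.base.map α).op))
          (PreFrobenioid.hasBiratSquares_of_isFrobenioid
            (C₁.isFrobenioid_treeCatVocab_of_isMonoidOn
              (C₁.isMonoidOn_ratFnFunctor_connectedPart_of_baseInj fun α => hBinj (C₁.base.map α).op)))) ∧
      PreFrobenioid.IsOfType (PreFrobenioid.IsSubQuasiFrobeniusTrivial C₁.toElem) ∧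
      ¬ PreFrobenioid.IsOfType (PreFrobenioid.IsGroupLikeObj C₁.toElem) :=
  thm37_i_node_ofRlfRWeak_connectedPart_of_baseInj dm hpf C₁ fun α => hBinj (C₁.base.map α).op

end OfRlfRWeak

end TemperedFrobenioid

/-! ### §3 MODEL OF RECORD over the genuine base `B^temp(Π^tp_X)⁰`, `Λ = ℝ`: the ℤ-tower — NO binder -/

namespace ZTowerTempered

variable {K : Type} [Field K] (X : SemiGraphs.TemperedArithmeticGroup.{0} K) (φ : X.Pi →* Multiplicative ℤ)
  (R S : ((ConnectedPart (BTemp X.Pi))ᵒᵖ ⥤ CommMonCat.{0}) → Prop)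

/-- `hBinj` at the ℤ-tower `Λ = ℝ` data: the pull-backs of `B₀^ℝ = ℝ·Φ₀^birat` along EVERY morphism of `CosetCat Π^tp_X` are injective
(abc-iut-w6-d048's `ofRlfRWeak_hBinj_of_reflects` ⟸ injective, divisibility-reflecting `Φ₀`-transitions of `ofGaloisActionCosetCat`).
[cite: MochizukiEtTh2009, Def 3.6 p.77] -/
theorem hBinjR {Y Y' : (CosetCat X.Pi)ᵒᵖ} (g : Y ⟶ Y') :
    Injective ((RealifiedDivisorMonoids.ofRlfRWeak (dm X φ) (hpf X φ)).BΛ.map g).hom :=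
  RealifiedDivisorMonoids.ofRlfRWeak_hBinj_of_reflects (dm X φ) (hpf X φ)
    (fun g => DivisorMonoids.ofGaloisActionCosetCat_Φ₀_map_injective X.isTempered _ _ g)
    (fun g a b h => DivisorMonoids.ofGaloisActionCosetCat_Φ₀_map_reflects_dvd X.isTempered _ _ g a b h) g

/-- «`B` is a monoid on `D`» at the `Λ = ℝ` ℤ-tower — NO binder. [cite: MochizukiFrdI2008, Def. 1.1 (ii) p.19] -/
theorem isMonoidOn_ratFnFunctor_temperedFrobenioidR : IsMonoidOn (temperedFrobenioidR X φ R S).ratFnFunctor :=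
  (temperedFrobenioidR X φ R S).isMonoidOn_ratFnFunctor_connectedPart_of_baseInj fun _ => hBinjR X φ _

/-- **[EtTh] Thm 3.7 (i) — ALL SEVEN CLAUSES with NO hypothesis at the `Λ = ℝ` ℤ-tower tempered Frobenioid over the GENUINE base
`B^temp(Π^tp_X)⁰`** (every `X`, every character `φ`): unit-profinite clause vacuous (`Λ = ℝ`), unit-trivial by `ofRlfRWeak_divΛ_injective`,
isotropic / model / birationally Frobenius-normalized / sub-quasi-Frobenius-trivial / not group-like by the tree's [FrdI] closers — the
first instance of the (i) node over a multi-object genuine base. [cite: MochizukiEtTh2009, Thm 3.7 (i) p.79] -/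
theorem thm37_i_temperedFrobenioidR :
    ((temperedFrobenioidR X φ R S).monoidType = MonoidType.Z →
        PreFrobenioid.IsOfUnitProfiniteType (temperedFrobenioidR X φ R S).toElem) ∧
      ((temperedFrobenioidR X φ R S).monoidType = MonoidType.R →
        PreFrobenioid.IsOfType (PreFrobenioid.IsUnitTrivial (temperedFrobenioidR X φ R S).toElem)) ∧
      PreFrobenioid.IsOfIsotropicType (temperedFrobenioidR X φ R S).toElem ∧
      PreFrobenioid.IsOfModelType (temperedFrobenioidR X φ R S).toElem
        ((temperedFrobenioidR X φ R S).isFrobenioid_treeCatVocab_of_isMonoidOn (isMonoidOn_ratFnFunctor_temperedFrobenioidR X φ R S))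
        (PreFrobenioid.hasBiratSquares_of_isFrobenioid
          ((temperedFrobenioidR X φ R S).isFrobenioid_treeCatVocab_of_isMonoidOn
            (isMonoidOn_ratFnFunctor_temperedFrobenioidR X φ R S))) ∧
      PreFrobenioidData.IsOfBiratFrobeniusNormalizedType
        (PreFrobenioid.biratData
          ((temperedFrobenioidR X φ R S).isFrobenioid_treeCatVocab_of_isMonoidOn (isMonoidOn_ratFnFunctor_temperedFrobenioidR X φ R S))
          (PreFrobenioid.hasBiratSquares_of_isFrobenioid
            ((temperedFrobenioidR X φ R S).isFrobenioid_treeCatVocab_of_isMonoidOn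
              (isMonoidOn_ratFnFunctor_temperedFrobenioidR X φ R S)))) ∧
      PreFrobenioid.IsOfType (PreFrobenioid.IsSubQuasiFrobeniusTrivial (temperedFrobenioidR X φ R S).toElem) ∧
      ¬ PreFrobenioid.IsOfType (PreFrobenioid.IsGroupLikeObj (temperedFrobenioidR X φ R S).toElem) :=
  TemperedFrobenioid.thm37_i_node_ofRlfRWeak_connectedPart_of_baseInj (dm X φ) (hpf X φ) (temperedFrobenioidR X φ R S)
    fun _ => hBinjR X φ _

/-- In particular the `Λ = ℝ` ℤ-tower model is of UNIT-TRIVIAL type, outright. [cite: MochizukiEtTh2009, Thm 3.7 (i) p.79] -/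
theorem isUnitTrivial_temperedFrobenioidR :
    PreFrobenioid.IsOfType (PreFrobenioid.IsUnitTrivial (temperedFrobenioidR X φ R S).toElem) :=
  (thm37_i_temperedFrobenioidR X φ R S).2.1 rfl

/-! ### §4 `Λ = ℤ` at the ℤ-tower: clauses (2)–(7) with NO hypothesis; clause (1) on the binder `hP34` -/

/-- The `Λ = ℤ` ℤ-tower tempered Frobenioid has monoid type `ℤ`. [cite: MochizukiEtTh2009, Def 3.6 p.77] -/
theorem temperedFrobenioid_monoidType : (temperedFrobenioid X φ R S).monoidType = MonoidType.Z := rfl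

/-- «`B` is a monoid on `D`» at the `Λ = ℤ` ℤ-tower — NO binder (`hBD` is `ZTowerTempered.hBD`). [cite: MochizukiFrdI2008, Def. 1.1 (ii) p.19] -/
theorem isMonoidOn_ratFnFunctor_temperedFrobenioid : IsMonoidOn (temperedFrobenioid X φ R S).ratFnFunctor :=
  (temperedFrobenioid X φ R S).isMonoidOn_ratFnFunctor_connectedPart_of_baseInj fun α => hBD X φ R S α

/-- **[EtTh] Thm 3.7 (i), clauses (2)–(7), with NO hypothesis at the `Λ = ℤ` ℤ-tower over `B^temp(Π^tp_X)⁰`** (clause (2) vacuous,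
(3)–(7) the `Λ`-free clauses).  Clause (1) «unit-profinite» is NOT claimed here: print's route is Prop. 3.4 (ii) iso 1 `Ker ≅ O_L^×`
(`hP34`), unavailable at a combinatorial model. [cite: MochizukiEtTh2009, Thm 3.7 (i) p.79] -/
theorem thm37_i_clauses_two_to_seven_temperedFrobenioid :
    ((temperedFrobenioid X φ R S).monoidType = MonoidType.R →
        PreFrobenioid.IsOfType (PreFrobenioid.IsUnitTrivial (temperedFrobenioid X φ R S).toElem)) ∧
      PreFrobenioid.IsOfIsotropicType (temperedFrobenioid X φ R S).toElem ∧
      PreFrobenioid.IsOfModelType (temperedFrobenioid X φ R S).toElem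
        ((temperedFrobenioid X φ R S).isFrobenioid_treeCatVocab_of_isMonoidOn (isMonoidOn_ratFnFunctor_temperedFrobenioid X φ R S))
        (PreFrobenioid.hasBiratSquares_of_isFrobenioid
          ((temperedFrobenioid X φ R S).isFrobenioid_treeCatVocab_of_isMonoidOn
            (isMonoidOn_ratFnFunctor_temperedFrobenioid X φ R S))) ∧
      PreFrobenioidData.IsOfBiratFrobeniusNormalizedType
        (PreFrobenioid.biratData
          ((temperedFrobenioid X φ R S).isFrobenioid_treeCatVocab_of_isMonoidOn (isMonoidOn_ratFnFunctor_temperedFrobenioid X φ R S))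
          (PreFrobenioid.hasBiratSquares_of_isFrobenioid
            ((temperedFrobenioid X φ R S).isFrobenioid_treeCatVocab_of_isMonoidOn
              (isMonoidOn_ratFnFunctor_temperedFrobenioid X φ R S)))) ∧
      PreFrobenioid.IsOfType (PreFrobenioid.IsSubQuasiFrobeniusTrivial (temperedFrobenioid X φ R S).toElem) ∧
      ¬ PreFrobenioid.IsOfType (PreFrobenioid.IsGroupLikeObj (temperedFrobenioid X φ R S).toElem) :=
  ⟨fun h => absurd ((temperedFrobenioid_monoidType X φ R S).symm.trans h) (by decide),
    (temperedFrobenioid X φ R S).thm37_i_treeClauses5_treeCatVocab (isMonoidOn_ratFnFunctor_temperedFrobenioid X φ R S)⟩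

/-- **The full (i) node at the `Λ = ℤ` ℤ-tower, modulo `hP34` ALONE** (Prop. 3.4 (ii) iso 1 in tree currency for some p-adic `L`).
[cite: MochizukiEtTh2009, Thm 3.7 (i) p.79] -/
theorem thm37_i_node_temperedFrobenioid {p : ℕ} [Fact p.Prime]
    (hP34 : ∀ A : (ConnectedPart (BTemp X.Pi))ᵒᵖ, ∃ L : PadicFrd.PadicFld.{uK} p, L.IsPadicLocal ∧
      Nonempty ((((RealifiedDivisorMonoids.ofRlfZWeak (dm X φ) (hpf X φ)).divΛ ((temperedFrobenioid X φ R S).baseOp A)).comp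
        (Units.coeHom ((RealifiedDivisorMonoids.ofRlfZWeak (dm X φ) (hpf X φ)).BΛ.obj ((temperedFrobenioid X φ R S).baseOp A)))).ker ≃*
        PadicFrd.unitSubgroup L.K)) :
    PreFrobenioid.IsOfUnitProfiniteType (temperedFrobenioid X φ R S).toElem ∧
      ((temperedFrobenioid X φ R S).monoidType = MonoidType.R →
        PreFrobenioid.IsOfType (PreFrobenioid.IsUnitTrivial (temperedFrobenioid X φ R S).toElem)) ∧
      PreFrobenioid.IsOfIsotropicType (temperedFrobenioid X φ R S).toElem ∧
      PreFrobenioid.IsOfModelType (temperedFrobenioid X φ R S).toElem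
        ((temperedFrobenioid X φ R S).isFrobenioid_treeCatVocab_of_isMonoidOn (isMonoidOn_ratFnFunctor_temperedFrobenioid X φ R S))
        (PreFrobenioid.hasBiratSquares_of_isFrobenioid
          ((temperedFrobenioid X φ R S).isFrobenioid_treeCatVocab_of_isMonoidOn
            (isMonoidOn_ratFnFunctor_temperedFrobenioid X φ R S))) ∧
      PreFrobenioidData.IsOfBiratFrobeniusNormalizedType
        (PreFrobenioid.biratData
          ((temperedFrobenioid X φ R S).isFrobenioid_treeCatVocab_of_isMonoidOn (isMonoidOn_ratFnFunctor_temperedFrobenioid X φ R S))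
          (PreFrobenioid.hasBiratSquares_of_isFrobenioid
            ((temperedFrobenioid X φ R S).isFrobenioid_treeCatVocab_of_isMonoidOn
              (isMonoidOn_ratFnFunctor_temperedFrobenioid X φ R S)))) ∧
      PreFrobenioid.IsOfType (PreFrobenioid.IsSubQuasiFrobeniusTrivial (temperedFrobenioid X φ R S).toElem) ∧
      ¬ PreFrobenioid.IsOfType (PreFrobenioid.IsGroupLikeObj (temperedFrobenioid X φ R S).toElem) :=
  have h := (temperedFrobenioid X φ R S).thm37_i_node (p := p) (isMonoidOn_ratFnFunctor_temperedFrobenioid X φ R S) (fun _ => hP34)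
    (fun h => absurd ((temperedFrobenioid_monoidType X φ R S).symm.trans h) (by decide))
  ⟨h.1 (temperedFrobenioid_monoidType X φ R S), h.2⟩

end ZTowerTempered

end Literature.AnabelianGeometry.EtaleTheta

end
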